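import Literature.NumberTheory.EllipticCurves.ShaRestriction
import Literature.NumberTheory.EllipticCurves.ZpExtensionDescentProofs
import HarnessLib

/-!
# Inflated classes from a cyclic quotient: `H¹(G/N, M^N)` for `G/N = ⟨σ⟩` on explicit cocycles

For a topological group `G`, a discrete `G`-module `M` and an open normal subgroup `N` with
CYCLIC quotient `G/N` of order `f`, generated by the class of `σ ∈ G`, the group
`H¹(G/N, M^N)` is classically `Ker(N_σ) / (σ - 1) M^N`, `N_σ = 1 + σ + ⋯ + σ^{f-1}` (cohomology of
finite cyclic groups: Serre, *Local Fields*, VIII.§4; only the elementary computations spelled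
out below are used). On the tree's model of `H¹(G/N, M^N)` as the classes INFLATED to
`H¹_cont(G, M)` from the crossed homomorphisms `G → M` vanishing on `N`
(`Literature.NumberTheory.EllipticCurves.cocyclesVanishingOn`, `inflClass`, file `ShaRestriction`),
this file proves the explicit version used to exhibit classes of prescribed order. The partial
norms `S(i) = ∑_{j<i} σ^j • P` are the tree's
`Literature.NumberTheory.EllipticCurves.ZpDescent.sPow` (`ZpExtensionDescentProofs`, with
`sPow_zero/one/succ_right/add/mul`); added here:

* `ZpDescent.sPow_eq_zero_of_dvd`, `sPow_smul_sub` (`S_i(σm - m) = σ^i m - m`), `sPow_nsmul`,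
  `sPow_sub`, `smul_pow_smul_of_mem`, `smul_sPow_of_mem` (`N`-invariance for `N` normal);
* `IsCyclicQuotient N σ f`: `σ^d ∈ N ↔ f ∣ d` and `G = ⋃_i σ^i N`;
* `IsCyclicQuotient.exists_cocyclesVanishingOn`: for `P ∈ M^N` with `N_σ(P) = S(f) = 0` there is
  a crossed homomorphism `a_P : G → M` vanishing on `N` with `a_P(σ^i n) = S(i)` — the cocycle of
  `G/N = ℤ/f` attached to `P ∈ Ker N_σ`;
* `IsCyclicQuotient.exists_inflClass`: its class `c = [a_P] ∈ (inflClass M N).range` satisfies,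
  for every `k : ℕ`, `k • c = 0 ↔ ∃ m ∈ M^N, k • P = σ • m - m` (that is,
  `H¹(⟨σ̄⟩, A) = Ker N_σ / (σ - 1) A` read on explicit classes);
* `IsCyclicQuotient.exists_inflClass_of_quotient`: **classes of order `n` from a `σ`-trivial
  quotient** — given a subgroup `A₀` of `M` such that `σ` acts trivially on `M^N` modulo `A₀`, an
  `N`-invariant `P₁` whose multiples `k P₁`, `0 < k < c`, avoid `A₀` while `c P₁ ∈ A₀`, and the
  two halves "`H¹(⟨σ̄⟩, M^N) → H¹(⟨σ̄⟩, M^N/A₀)` is surjective and injective" in the cyclic model,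
  there is a class in `(inflClass M N).range` killed by `n` but by no `0 < k < n`, for every
  `n ∣ c`, `n ∣ f`. This is the bookkeeping behind "`H¹(G₀, E(L)) ≅ Hom(G₀, E(L)/E₀(L)) ≅ ℤ/gℤ`,
  `g = (c_ℓ, |G₀|)`" in Matsuno 2009, Lemma 4.1 (`A₀ = E₀(L)`;
  `Literature/Barriers/BirchSwinnertonDyer/DescentDefectUnboundedMatsunoLemma41Proofs.lean`).

Everything here is proved; no number theory is involved.

## References

* J.-P. Serre, *Local Fields*, GTM 67 (1979), VIII.§4 (cohomology of finite cyclic groups).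
  [SerreLocalFields1979]
* J.-P. Serre, *Galois Cohomology* (1997), I.§2.6(b), I.§5.8 (inflation).
  [SerreGaloisCohomology1997]
-/

noncomputable section

open scoped Classical

open Finset

universe u

namespace Literature.NumberTheory.EllipticCurves

/-! ## More algebra of the partial norms `ZpDescent.sPow σ P i = ∑_{j<i} σ^j • P` -/

namespace ZpDescent

section SPow

variable {G : Type*} [Group G] {M : Type*} [AddCommGroup M] [DistribMulAction G M]

/-- If `S(f) = 0` then `S(d) = 0` for every multiple `d` of `f` (`S(f q) = ∑_{i<q} σ^{fi} S(f)`,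
`sPow_mul`). [folklore] -/
theorem sPow_eq_zero_of_dvd (σ : G) (P : M) {f d : ℕ} (hf : sPow σ P f = 0) (hd : f ∣ d) :
    sPow σ P d = 0 := by
  obtain ⟨q, rfl⟩ := hd
  rw [sPow_mul]
  exact Finset.sum_eq_zero fun i _ ↦ by rw [hf, smul_zero]

/-- **Partial norms of a coboundary telescope**: `S_i(σ • m - m) = σ^i • m - m`. [folklore] -/
theorem sPow_smul_sub (σ : G) (m : M) (i : ℕ) : sPow σ (σ • m - m) i = σ ^ i • m - m := by
  induction i with
  | zero => simp [sPow_zero]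
  | succ i ih =>
    rw [sPow_succ_right, ih, smul_sub, ← mul_smul, ← pow_succ]
    abel

/-- `S_i(k • P) = k • S_i(P)`. [folklore] -/
theorem sPow_nsmul (σ : G) (P : M) (k i : ℕ) : sPow σ (k • P) i = k • sPow σ P i := by
  simp only [sPow, Finset.smul_sum, smul_comm _ k P]

/-- `S_i(P - Q) = S_i(P) - S_i(Q)`. [folklore] -/
theorem sPow_sub (σ : G) (P Q : M) (i : ℕ) : sPow σ (P - Q) i = sPow σ P i - sPow σ Q i := by
  simp only [sPow, smul_sub, Finset.sum_sub_distrib]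

/-- Powers of `σ` applied to an `N`-invariant element are `N`-invariant, for `N` normal
(`n σ^j P = σ^j (σ^{-j} n σ^j) P = σ^j P`). [folklore] -/
theorem smul_pow_smul_of_mem {N : Subgroup G} [hN : N.Normal] (σ : G) {P : M}
    (hP : ∀ n ∈ N, n • P = P) {n : G} (hn : n ∈ N) (j : ℕ) : n • σ ^ j • P = σ ^ j • P := by
  have hmem : (σ ^ j)⁻¹ * n * σ ^ j ∈ N := hN.conj_mem' n hn (σ ^ j)
  calc n • σ ^ j • P = σ ^ j • (((σ ^ j)⁻¹ * n * σ ^ j) • P) := by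
        rw [← mul_smul, ← mul_smul, ← mul_assoc, ← mul_assoc, mul_inv_cancel, one_mul]
    _ = σ ^ j • P := by rw [hP _ hmem]

/-- The partial norms of an `N`-invariant element are `N`-invariant, for `N` normal. [folklore] -/
theorem smul_sPow_of_mem {N : Subgroup G} [N.Normal] (σ : G) {P : M}
    (hP : ∀ n ∈ N, n • P = P) {n : G} (hn : n ∈ N) (i : ℕ) : n • sPow σ P i = sPow σ P i := by
  simp only [sPow, Finset.smul_sum]
  exact Finset.sum_congr rfl fun j _ ↦ smul_pow_smul_of_mem σ hP hn j

end SPow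

end ZpDescent

open ZpDescent

/-! ## Cyclic quotients and the cocycle attached to `P ∈ Ker N_σ` -/

section Cyclic

variable {G : Type u} [Group G] {M : Type u} [AddCommGroup M] [DistribMulAction G M]

/-- **`G/N` is cyclic of order `f`, generated by the class of `σ`**: `σ^d ∈ N` exactly when
`f ∣ d`, and every element of `G` lies in some coset `σ^i N`. (For `G = Γ_K`, `N = Γ_L` with
`L/K` finite cyclic: `σ` restricts to a generator of `Gal(L/K)`, `f = [L : K]`.) [folklore] -/
structure IsCyclicQuotient (N : Subgroup G) (σ : G) (f : ℕ) : Prop where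
  /-- `σ^d ∈ N ↔ f ∣ d`: the class of `σ` has order `f` in `G/N`. -/
  pow_mem_iff : ∀ d : ℕ, σ ^ d ∈ N ↔ f ∣ d
  /-- `G = ⋃_i σ^i N`: the class of `σ` generates `G/N`. -/
  exists_pow : ∀ g : G, ∃ i : ℕ, (σ ^ i)⁻¹ * g ∈ N

/-- For `P` with `S(f) = 0`, the partial norm `S(i)` depends only on the coset `σ^i N`: if
`σ^i N = σ^{i'} N ∋ g` then `S(i) = S(i')` (`σ^{i'-i} ∈ N`, so `f ∣ i' - i` and
`S(i') = S(i) + σ^i S(i'-i) = S(i)`). [folklore] -/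
theorem IsCyclicQuotient.sPow_eq_of_mem {N : Subgroup G} {σ : G} {f : ℕ}
    (hσ : IsCyclicQuotient N σ f) {P : M} (hnorm : sPow σ P f = 0) {g : G} {i i' : ℕ}
    (hi : (σ ^ i)⁻¹ * g ∈ N) (hi' : (σ ^ i')⁻¹ * g ∈ N) : sPow σ P i = sPow σ P i' := by
  wlog h : i ≤ i' generalizing i i'
  · exact (this hi' hi (le_of_not_ge h)).symm
  obtain ⟨d, rfl⟩ := Nat.exists_eq_add_of_le h
  have hd : σ ^ d ∈ N := by
    have hmem := N.mul_mem hi (N.inv_mem hi')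
    have key : (σ ^ i)⁻¹ * g * ((σ ^ (i + d))⁻¹ * g)⁻¹ = σ ^ d := by
      rw [mul_inv_rev, inv_inv, mul_assoc, mul_inv_cancel_left, pow_add, inv_mul_cancel_left]
    rwa [key] at hmem
  rw [sPow_add, sPow_eq_zero_of_dvd σ P hnorm ((hσ.pow_mem_iff d).mp hd), smul_zero, add_zero]

/-- **The cocycle of `G/N = ⟨σ⟩` attached to `P ∈ Ker N_σ`.** Let `G/N` be cyclic of order `f`
generated by `σ` (`IsCyclicQuotient`), `N` normal, and `P ∈ M^N` with
`N_σ(P) = ∑_{j<f} σ^j P = 0`. Then there is a crossed homomorphism `a_P : G → M` vanishing on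
`N` with `a_P(g) = ∑_{j<i} σ^j P` whenever `g ∈ σ^i N` (well defined by
`IsCyclicQuotient.sPow_eq_of_mem`; the crossed-homomorphism identity is
`S(i+k) = S(i) + σ^i S(k)` together with the `N`-invariance of the `S(k)`). This is the
`1`-cocycle of the cyclic group `G/N` with `a(σ̄) = P` (Serre, *Local Fields*, VIII.§4).
[folklore] -/
theorem IsCyclicQuotient.exists_cocyclesVanishingOn {N : Subgroup G} [N.Normal] {σ : G} {f : ℕ}
    (hσ : IsCyclicQuotient N σ f) {P : M} (hP : ∀ n ∈ N, n • P = P) (hnorm : sPow σ P f = 0) :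
    ∃ a : cocyclesVanishingOn M N,
      ∀ (g : G) (i : ℕ), (σ ^ i)⁻¹ * g ∈ N → a.1 g = sPow σ P i := by
  choose idx hidx using hσ.exists_pow
  have hwd : ∀ (g : G) (i : ℕ), (σ ^ i)⁻¹ * g ∈ N → sPow σ P (idx g) = sPow σ P i :=
    fun g i hi ↦ hσ.sPow_eq_of_mem hnorm (hidx g) hi
  refine ⟨⟨fun g ↦ sPow σ P (idx g), fun g h ↦ ?_, fun n hn ↦ ?_⟩, fun g i hi ↦ hwd g i hi⟩
  · -- crossed homomorphism: `g h ∈ σ^{idx g + idx h} N`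
    have hgh : (σ ^ (idx g + idx h))⁻¹ * (g * h) ∈ N := by
      have key : (σ ^ (idx g + idx h))⁻¹ * (g * h) =
          (σ ^ idx h)⁻¹ * ((σ ^ idx g)⁻¹ * g) * σ ^ idx h * ((σ ^ idx h)⁻¹ * h) := by
        rw [pow_add, mul_inv_rev]
        simp only [mul_assoc, mul_inv_cancel_left]
      rw [key]
      exact N.mul_mem (Subgroup.Normal.conj_mem' ‹N.Normal› _ (hidx g) _) (hidx h)
    change sPow σ P (idx (g * h)) = sPow σ P (idx g) + g • sPow σ P (idx h)
    rw [hwd (g * h) _ hgh, sPow_add]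
    congr 1
    conv_rhs => rw [← mul_inv_cancel_left (σ ^ idx g) g, mul_smul, smul_sPow_of_mem σ hP (hidx g)]
  · -- vanishing on `N`: `n ∈ σ^0 N`
    change sPow σ P (idx n) = 0
    rw [hwd n 0 (by simpa using hn), sPow_zero]

end Cyclic

/-! ## The order of the inflated classes -/

section Inflation

variable {G : Type u} [Group G] [TopologicalSpace G] [IsTopologicalGroup G]
variable {M : Type u} [AddCommGroup M] [DistribMulAction G M] [TopologicalSpace M]
  [DiscreteTopology M]

/-- **The order of the inflated class `[a_P]`.** In the situation of
`IsCyclicQuotient.exists_cocyclesVanishingOn` (with `N` open), the class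
`c = [a_P] ∈ H¹_cont(G, M)` of the cocycle attached to `P ∈ Ker N_σ ∩ M^N` lies in the inflated
subgroup `(inflClass M N hN).range ≅ H¹(G/N, M^N)` and, for every `k : ℕ`,
`k • c = 0 ↔ ∃ m ∈ M^N, k • P = σ • m - m`: a multiple `k • a_P = a_{kP}` is a coboundary iff it
is the coboundary of an `N`-invariant `m` (injectivity of inflation), iff `k P = a_{kP}(σ) =
σ m - m` — and conversely `a_{σm-m}(σ^i n) = S_i(σm - m) = σ^i m - m = (σ^i n) m - m`. This is the
isomorphism `H¹(⟨σ̄⟩, A) ≅ Ker N_σ / (σ - 1) A` of the cohomology of finite cyclic groups (Serre,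
*Local Fields*, VIII.§4) in the form "the class of `P ∈ Ker N_σ` has order `n` iff
`n P ∈ (σ-1)A` and `k P ∉ (σ-1)A` for `0 < k < n`". [folklore] -/
theorem IsCyclicQuotient.exists_inflClass {N : Subgroup G} [N.Normal] (hN : IsOpen (N : Set G))
    {σ : G} {f : ℕ} (hσ : IsCyclicQuotient N σ f) {P : M} (hP : ∀ n ∈ N, n • P = P)
    (hnorm : sPow σ P f = 0) :
    ∃ c ∈ (inflClass M N hN).range,
      ∀ k : ℕ, k • c = 0 ↔ ∃ m : M, (∀ n ∈ N, n • m = m) ∧ k • P = σ • m - m := by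
  obtain ⟨a, ha⟩ := hσ.exists_cocyclesVanishingOn hP hnorm
  have haσ : a.1 σ = P := by
    rw [ha σ 1 (by simp), sPow_one]
  refine ⟨inflClass M N hN a, ⟨a, rfl⟩, fun k ↦ ?_⟩
  rw [← map_nsmul, inflClass_apply, GaloisRepresentations.oneCocycleClass_eq_zero_iff]
  constructor
  · rintro ⟨m, hm⟩
    have hmN : ∀ n ∈ N, n • m = m := fun n hn ↦ by
      have h := hm n
      rw [discreteTopRep_ρ_apply, toContOneCocycle_apply, AddSubgroup.coe_nsmul, Pi.smul_apply,
        cocyclesVanishingOn.apply_of_mem a hn, smul_zero, eq_comm, sub_eq_zero] at h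
      exact h
    refine ⟨m, hmN, ?_⟩
    have h := hm σ
    rwa [discreteTopRep_ρ_apply, toContOneCocycle_apply, AddSubgroup.coe_nsmul, Pi.smul_apply,
      haσ] at h
  · rintro ⟨m, hmN, hk⟩
    refine ⟨m, fun g ↦ ?_⟩
    obtain ⟨i, hi⟩ := hσ.exists_pow g
    rw [discreteTopRep_ρ_apply, toContOneCocycle_apply, AddSubgroup.coe_nsmul, Pi.smul_apply,
      ha g i hi, ← sPow_nsmul, hk, sPow_smul_sub]
    congr 1
    conv_rhs => rw [← mul_inv_cancel_left (σ ^ i) g, mul_smul, hmN _ hi]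

/-- **Classes of order `n` from a `σ`-trivial quotient** (the bookkeeping of
`H¹(G₀, E(L)) ≅ H¹(G₀, E(L)/E₀(L)) = Hom(G₀, E(L)/E₀(L)) ≅ ℤ/(c, f)` in Matsuno 2009, Lemma 4.1,
with `A₀ = E₀(L)`). Let `G/N = ⟨σ̄⟩` be cyclic of order `f` (`N` open and normal), `A₀ ≤ M` a
subgroup, and assume:
* (`htriv`) `σ` acts trivially on `M^N` modulo `A₀`: `σ P - P ∈ A₀` for `P ∈ M^N`;
* (`hP₁`, `hcP₁`, `hkP₁`) an `N`-invariant `P₁` with `c P₁ ∈ A₀` and `k P₁ ∉ A₀` for `0 < k < c`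
  ("the class of `P₁` has order `c` in `M^N/A₀`"), `0 < c`;
* (`hsurj`) for `P₁ ∈ M^N` with `N_σ P₁ ∈ A₀` there is `P ∈ M^N` with `N_σ P = 0` and
  `P - P₁ ∈ A₀ + (σ - 1) M^N` (SURJECTIVITY of `H¹(⟨σ̄⟩, M^N) → H¹(⟨σ̄⟩, M^N/A₀)` on cyclic
  cocycles);
* (`hinj`) for `P ∈ M^N ∩ A₀` with `N_σ P = 0` there is `m ∈ M^N` with `P = σ m - m`
  (INJECTIVITY, for the classes that vanish already at cocycle level modulo `A₀`).
Then for `n ∣ c`, `n ∣ f` there is a class `x ∈ (inflClass M N hN).range` with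
`n • x = 0` and `k • x ≠ 0` for `0 < k < n`. Proof: `P₂ = (c/n) P₁`; `N_σ P₂ ≡ f P₂ ≡ 0`
modulo `A₀`; `hsurj` gives `P ≡ P₂` with `N_σ P = 0`; take `x = [a_P]`
(`IsCyclicQuotient.exists_inflClass`); `n P ∈ A₀`, so `n • x = 0` by `hinj`; if `k • x = 0` then
`k P = σ m - m ∈ A₀`, hence `k (c/n) P₁ ∈ A₀` with `0 < k (c/n) < c`. [folklore] -/
theorem IsCyclicQuotient.exists_inflClass_of_quotient {N : Subgroup G} [N.Normal]
    (hN : IsOpen (N : Set G)) {σ : G} {f : ℕ} (hσ : IsCyclicQuotient N σ f) (A₀ : AddSubgroup M)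
    (htriv : ∀ P : M, (∀ τ ∈ N, τ • P = P) → σ • P - P ∈ A₀)
    {c : ℕ} (hc : 0 < c) {P₁ : M} (hP₁ : ∀ τ ∈ N, τ • P₁ = P₁) (hcP₁ : c • P₁ ∈ A₀)
    (hkP₁ : ∀ k : ℕ, 0 < k → k < c → k • P₁ ∉ A₀)
    (hsurj : ∀ P₁ : M, (∀ τ ∈ N, τ • P₁ = P₁) → sPow σ P₁ f ∈ A₀ →
      ∃ P : M, (∀ τ ∈ N, τ • P = P) ∧ sPow σ P f = 0 ∧
        ∃ Q : M, (∀ τ ∈ N, τ • Q = Q) ∧ P - P₁ - (σ • Q - Q) ∈ A₀)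
    (hinj : ∀ P : M, (∀ τ ∈ N, τ • P = P) → sPow σ P f = 0 → P ∈ A₀ →
      ∃ m : M, (∀ τ ∈ N, τ • m = m) ∧ P = σ • m - m)
    {n : ℕ} (hnc : n ∣ c) (hnf : n ∣ f) :
    ∃ x ∈ (inflClass M N hN).range, n • x = 0 ∧ ∀ k : ℕ, 0 < k → k < n → k • x ≠ 0 := by
  obtain ⟨q, hq⟩ := hnc
  obtain ⟨r, hr⟩ := hnf
  have hq0 : 0 < q := Nat.pos_of_ne_zero fun h ↦ by rw [h, mul_zero] at hq; omega
  -- `σ^j P - P ∈ A₀` and `S_i(P) - i • P ∈ A₀` for `N`-invariant `P`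
  have hpow : ∀ P : M, (∀ τ ∈ N, τ • P = P) → ∀ j : ℕ, σ ^ j • P - P ∈ A₀ := by
    intro P hP j
    induction j with
    | zero => simp
    | succ j ih =>
      have h := htriv (σ ^ j • P) fun τ hτ ↦ smul_pow_smul_of_mem σ hP hτ j
      rw [← mul_smul, ← pow_succ'] at h
      have := A₀.add_mem h ih
      rwa [sub_add_sub_cancel] at this
  have hS : ∀ P : M, (∀ τ ∈ N, τ • P = P) → ∀ i : ℕ, sPow σ P i - i • P ∈ A₀ := by
    intro P hP i
    induction i with
    | zero => simp [sPow_zero]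
    | succ i ih =>
      rw [sPow_succ_right, succ_nsmul]
      have := A₀.add_mem ih (hpow P hP i)
      convert this using 1
      abel
  -- `P₂ = q • P₁`, `q = c / n`
  set P₂ : M := q • P₁ with hP₂_def
  have hP₂ : ∀ τ ∈ N, τ • P₂ = P₂ := fun τ hτ ↦ by rw [hP₂_def, smul_comm, hP₁ τ hτ]
  have hnP₂ : n • P₂ = c • P₁ := by rw [hP₂_def, ← mul_nsmul', ← hq]
  have hkP₂ : ∀ k : ℕ, 0 < k → k < n → k • P₂ ∉ A₀ := fun k hk hkn h ↦ by
    refine hkP₁ (k * q) (Nat.mul_pos hk hq0) ?_ ?_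
    · calc k * q < n * q := Nat.mul_lt_mul_of_pos_right hkn hq0
        _ = c := hq.symm
    · rw [mul_nsmul']
      rwa [hP₂_def] at h
  -- `N_σ P₂ ∈ A₀`
  have hNP₂ : sPow σ P₂ f ∈ A₀ := by
    have hfP₂ : f • P₂ ∈ A₀ := by
      rw [hr, mul_comm, mul_nsmul', hnP₂]
      exact A₀.nsmul_mem hcP₁ r
    have := A₀.add_mem (hS P₂ hP₂ f) hfP₂
    rwa [sub_add_cancel] at this
  -- surjectivity: `P ≡ P₂` with `N_σ P = 0`; its class `x`
  obtain ⟨P, hP, hnorm, Q, hQ, hPQ⟩ := hsurj P₂ hP₂ hNP₂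
  obtain ⟨x, hx, hiff⟩ := hσ.exists_inflClass hN hP hnorm
  have hkey : ∀ k : ℕ, k • P - k • P₂ ∈ A₀ := fun k ↦ by
    have h1 := A₀.nsmul_mem hPQ k
    have h2 := A₀.nsmul_mem (htriv Q hQ) k
    have := A₀.add_mem h1 h2
    rw [nsmul_sub, nsmul_sub, sub_add_cancel] at this
    exact this
  refine ⟨x, hx, ?_, fun k hk hkn hkx ↦ ?_⟩
  · -- `n • x = 0`: `n P ∈ A₀`, `N_σ (n P) = 0`, so `n P = σ m - m` by injectivity
    rw [hiff n]
    have hnP : n • P ∈ A₀ := by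
      have := A₀.add_mem (hkey n) (hnP₂ ▸ hcP₁ : n • P₂ ∈ A₀)
      rwa [sub_add_cancel] at this
    exact hinj (n • P) (fun τ hτ ↦ by rw [smul_comm, hP τ hτ])
      (by rw [sPow_nsmul, hnorm, smul_zero]) hnP
  · -- `k • x ≠ 0` for `0 < k < n`
    rw [hiff k] at hkx
    obtain ⟨m, hm, hkm⟩ := hkx
    have hkP : k • P ∈ A₀ := hkm ▸ htriv m hm
    have : k • P₂ ∈ A₀ := by
      have := A₀.sub_mem hkP (hkey k)
      rwa [sub_sub_cancel] at this
    exact hkP₂ k hk hkn this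

end Inflation

end Literature.NumberTheory.EllipticCurves

end
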